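import Summits.Parity.BatemanHorn.Theses.IsogenyRedei
import Literature.NumberTheory.EllipticCurves.TwoIsogenySelmerGroup

/-!
# Line `cassels-local-images-mod4` — checked skeleton for crux `PencilSelmerDictionary` (stmt-Parity-11584)

Route `route-Parity-IsogenyRedei` (sub-problem `BatemanHorn`); crux decl
`Summit.Parity.BatemanHorn.Theses.IsogenyRedei.PencilSelmerDictionary`:

  `∃ M, ∃ w : ℕ → ℤ, (∀ t, w (t + 2^M) = w t) ∧ ∀ t ≥ 1,
      (-1)^{selmerCorank E_t 2} = -(w t * (-1)^{#{odd primes p ∣ t²+1}})`,  `E_t = ⟨0, 2t, 0, t²+1, 0⟩`.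

**Idea (card `Ideas/cassels-local-images-mod4.md`, triage r1: 3 × pass).** Cross from the `2^∞`-Selmer corank to
the two EXPLICIT isogeny Selmer sets of the pencil by the tree's named fact
`Literature.NumberTheory.EllipticCurves.cassels_selmerCorank_two_parity`
(`(-1)^corank = (-1)^{s+s'}`, `s = dim S(2t, t²+1)` = descent on the divisors of `b = t²+1`,
`s' = dim S(-4t, -4)` = descent on the divisors of `b' = a² - 4b = -4`, CONSTANT), and COUNT both finite sets place
by place: at the odd places the `b`-side conditions are VACUOUS (split node carrying the kernel, `(2t|p) = +1`) and the
`b'`-side condition is "`d` is a square mod `p`"; the real place kills `d < 0` on the `b`-side only; the place `2`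
contributes an explicit table in `t mod 8`.  The Chebotarev bit `ε(t) = [∃ p ∣ t²+1, p ≡ 5 (8)]` enters `s` and `s'`
separately and CANCELS in `s + s'`, leaving `s + s' ≡ ω_odd(t²+1) + [t mod 4 ∈ {2,3}] (mod 2)`: the crux with
`M = 2`, `w = (-1,-1,+1,+1)[t mod 4]` (cdisprove's Lean-certified forced table `forced_w_values_upto_eight`).

**Registered stubs (the only `sorry`s):** `stub_cassels` (discharge of the named fact; XL, literature-prover
obligation, the line is conditional on exactly this), `stub_oddPlacesB`, `stub_twoAdicB`, `stub_oddPlacesBprime`,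
`stub_twoAdicBprime`, `stub_count`.  **Composition** `PencilSelmerDictionary_of` (closed term, no `sorry` outside the
stubs): `selmerB_eq` (S(2t,t²+1) = the explicit divisor set, from stubs 2–3 + the real-place lemma
`not_isSoluble_real_of_neg` proved here), `selmerBprime_eq` (S(-4t,-4) = `{±1} ∪ {±2 if …}`, from stubs 4–5),
`stub_count`, `stub_cassels`, witness `M = 2`, `w t = if t % 4 < 2 then -1 else 1`.

**Disproof.lean used** (refuter-cdisprove-stmt-Parity-11584, cycles 1–5, read through its evidence notes — the file is
not mounted on planner boxes): §1 `iff_periodic` / §2 `withoutPeriodicity_trivial` (periodicity is the only content —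
honoured: the line outputs the period-4 table itself); §3/§3b w₃-obstruction (`Tables.helfgottClauses_flip`,
`exists_witnesses_opposite_at_three`: tree root-number facts cannot give the `2^M` shape) — EVADED: no root number is
formed, `3 ∤ t²+1` is a good prime handled inside `stub_oddPlacesB/Bprime`; §4 `Sharp`/`of_sharp` — this line IS the
sharp table; §4b `forced_w_values_upto_eight`, `sharp_table_holds_upto_eight` (16 Lean Finsets `t ≤ 8`, granted only the
Cassels fact) — the explicit sets `setB`, `setBprime` below reproduce all 16; §2b `Fibres.not_two_pow_nine_dvd_Δ`
(no 2-adic singular fibre) = the reason the 2-adic tables of stubs 3 and 5 are uniform in `t mod 8`/`d mod 16`.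
No `_false_without_` theorem is on record for this crux; the common obstruction named by all three triagers —
Cassels–Tate evenness must enter once — is `stub_cassels`.

Numerics: kit `verify_tables.py` (this seat; exact recursive p-adic decision from the DEFINITIONS): t ≤ 400 locally,
all stub tables and the count 0 failures; kit j011451 (t ≤ 1500) attached to the item; independent: j004946 (t ≤ 4000),
selmer_sets.py / j010879, j010573, j005061, cdisprove t ≤ 8 in Lean.
-/

noncomputable section

namespace Summit.Parity.BatemanHorn.Cruxes.PencilSelmerDictionary.CasselsLocalImagesMod4

open Literature.NumberTheory.EllipticCurves
open Summit.Parity.BatemanHorn.Theses.IsogenyRedei (PencilSelmerDictionary)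

/-! ## Explicit objects (abbreviations used by the composition; the stubs state them INLINE) -/

/-- The explicit `b`-side Selmer set `S(2t, t²+1)` as a set of natural numbers: the squarefree divisors `d` of
`t² + 1` passing the 2-adic table of `stub_twoAdicB` (odd places impose nothing, the real place forces `d > 0`). -/
def setB (t : ℕ) : Finset ℕ :=
  (t ^ 2 + 1).divisors.filter fun d : ℕ =>
    Squarefree d ∧ (t % 4 = 1 ∨ t % 4 = 2 ∨ d % 8 = 1 ∨ (t % 8 = 3 ∧ d % 16 = 10) ∨ (t % 8 = 7 ∧ d % 16 = 2))

/-- The explicit `b'`-side Selmer set `S(-4t, -4) ⊆ {±1, ±2}`: `±1` always; `±2` iff `t ≡ 0 (4)` or `t ≡ 7 (8)`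
(2-adic, `stub_twoAdicBprime`) and every odd prime factor of `t² + 1` is `≡ 1 (mod 8)` (`stub_oddPlacesBprime`). -/
def setBprime (t : ℕ) : Finset ℤ :=
  if (t % 4 = 0 ∨ t % 8 = 7) ∧ (∀ p ∈ (t ^ 2 + 1).primeFactors, p ≠ 2 → p % 8 = 1) then {1, -1, 2, -2}
  else {1, -1}

/-! ## Registered stubs (the only `sorry`s of the line) -/

/-- **stub_cassels** — DISCHARGE of the named Literature fact `cassels_selmerCorank_two_parity` (Cassels' formula for a
rational 2-isogeny in parity form: `(-1)^{corank Sel_{2^∞}(E/ℚ)} = (-1)^{dim S^{(φ)} + dim S^{(φ̂)}}` for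
`E : y² = x³ + ax² + bx`, `b(a² - 4b) ≠ 0`; Dokchitser–Dokchitser 2011 Crelle Thm 30 (arXiv:0906.1815 p. 9) with
Cassels 1965 Thm 1.1 / Klagsbrun 2016 Thm 3.5–3.6).  Registered as a stub so that the composition is a closed term;
size XL (Cassels–Tate pairing + Cassels' product formula; the tree has `exists_casselsTate_pairing` as a named fact and
the proved bridge `exists_selmerRank_eq_add`), a literature-prover obligation NOT expected inside this line: until it
earns `_holds` the line closes the crux `blocked-on: cassels_selmerCorank_two_parity`.  This is the one place where
Cassels–Tate evenness enters (the obstruction common to all six r1 ideas, TRIAGE-r1-3). -/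
theorem stub_cassels : cassels_selmerCorank_two_parity := by
  sorry

/-- **stub_oddPlacesB** — odd places impose NO condition on the `b`-side (`OddPrimeVacuity` of cards
toric-node-vacuity-cassels / `SplitFibreVacuous` of cassels-pair-split-fibres): for `t ≥ 1`, every squarefree
`d > 0` dividing `t² + 1` and every odd prime `p`, `w² = d u⁴ + 2t u²z² + ((t²+1)/d) z⁴` has a `ℚ_p`-point.
Why true: `p ∣ t²+1` ⇒ `p ≡ 1 (4)`, `t² ≡ -1`, the quadratic `dX² + 2tXZ + d'Z²` has discriminant `-4 ≡ (2t)²` and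
`(2t|p) = (2|p)(t|p) = +1` (t of order 4), so `q ≡ d·u²(u² + (2t/d)z²)` resp. (if `p ∣ d, p ∣ d'`) `q(1,1) ≡ 2t` is a
nonzero square — smooth `𝔽_p`-point + Hensel (`isSoluble_coe_of_smooth_zmod_point`); when `p ∥ t²+1` directly
`isSoluble_padic_of_not_sq_dvd_disc` (disc `= 256(t²+1)`); `p ∤ t²+1`, `p ≥ 5`: `isSoluble_padic_of_not_dvd_disc`;
`p = 3` (never divides `t²+1`): explicit smooth point mod 3 by cases on `(d, t, d') mod 3`.  Size M/L.
Numerics: 0 failures in 72 314 (t,d,p) cases t ≤ 4000 (j004946) and verify_tables.py S2 (t ≤ 400; j011451 t ≤ 1500). -/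
theorem stub_oddPlacesB :
    ∀ t : ℕ, 1 ≤ t → ∀ d : ℤ, 0 < d → Squarefree d → d ∣ (t : ℤ) ^ 2 + 1 →
      ∀ (p : ℕ) [Fact p.Prime], p ≠ 2 →
        ((twoIsogenyQuartic (2 * (t : ℤ)) d (((t : ℤ) ^ 2 + 1) / d)).map (Int.castRingHom ℚ_[p])).IsSoluble := by
  sorry

/-- **stub_twoAdicB** — the 2-adic table on the `b`-side (`TwoAdicImageTable`, image `B(t mod 8) = {1}, ⟨2,5⟩, ⟨5⟩,
⟨10⟩, {1}, ⟨2,5⟩, ⟨5⟩, ⟨2⟩ ⊂ ℚ₂ˣ/ℚ₂ˣ²` read on positive squarefree divisors, whose classes are `1, 5` (odd `d ≡ 1 (4)`)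
and `2, 10` (even `d`, `t` odd)): for `t ≥ 1` and squarefree `d > 0`, `d ∣ t²+1`,
`w² = d u⁴ + 2t u²z² + ((t²+1)/d) z⁴` is `ℚ₂`-soluble iff `t ≡ 1, 2 (4)` or `d ≡ 1 (8)` or
(`t ≡ 3 (8)` and `d ≡ 10 (16)`) or (`t ≡ 7 (8)` and `d ≡ 2 (16)`).
Why true / how: solubility depends only on `(t mod 16, d mod 32)` — indeed on the square class of `d` in `ℚ₂` and on
`t mod 8` — because `a² - 4dd' = -4` is constant (no 2-adic singular fibre, cdisprove `Fibres.not_two_pow_nine_dvd_Δ`):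
insoluble cells by residue exhaustion mod `2^k`, `k ≤ 6` (cdisprove's `not_isSoluble_padic_of_zmod` pattern, `decide`),
soluble cells by an approximate point + `exists_sq_eq_of_norm_sub_lt` / `exists_pow_dvd_imp_isSoluble_iff_int`.
Size L (finite but many cells; the reduction "only `d mod 16` matters" is the one idea).
Numerics: verify_tables.py S3, 0 failures t ≤ 400 (all d); = tables of j004946 / selmer_sets.py / j010573. -/
theorem stub_twoAdicB :
    ∀ t : ℕ, 1 ≤ t → ∀ d : ℤ, 0 < d → Squarefree d → d ∣ (t : ℤ) ^ 2 + 1 →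
      (((twoIsogenyQuartic (2 * (t : ℤ)) d (((t : ℤ) ^ 2 + 1) / d)).map (Int.castRingHom ℚ_[2])).IsSoluble ↔
        (t % 4 = 1 ∨ t % 4 = 2 ∨ d % 8 = 1 ∨ (t % 8 = 3 ∧ d % 16 = 10) ∨ (t % 8 = 7 ∧ d % 16 = 2))) := by
  sorry

/-- **stub_oddPlacesBprime** — the square rule on the `b'`-side (`OddPrimeSquareRule` / `SplitFibreResidue`): for
`t ≥ 1`, `d ∈ {±1, ±2}` and an odd prime `p`, `w² = d u⁴ - 4t u²z² - (4/d) z⁴` is `ℚ_p`-soluble iff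
(`p ∣ t²+1 → d = ±1 ∨ p ≡ 1 (8)`), i.e. iff `d` is a square mod every such `p` (`-1` is a square as `p ≡ 1 (4)`;
`(2|p) = +1 ⟺ p ≡ 1 (8)` given `p ≡ 1 (4)`).
Why true: `p ∣ t²+1` ⇒ `d·q ≡ (du² - 2tz²)² (mod p)`, a constant times a square: soluble iff `(d|p) = +1`
(smooth point `(1:0:√d)` + Hensel; insoluble by the valuation/residue argument on `d w² = (du² - 2tz²)² - 4(t²+1)z⁴`,
incl. `p² ∣ t²+1`, e.g. `t = 7, p = 5`); `p ∤ t²+1`: good reduction (`isSoluble_padic_of_not_dvd_disc`, disc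
`= -2¹⁴(t²+1)²`; `p = 3` by an explicit point mod 3).  Size M/L.
Numerics: verify_tables.py S4 0 failures t ≤ 400; j004946 claim (b) 0 failures t ≤ 4000; cdisprove t = 7, 8. -/
theorem stub_oddPlacesBprime :
    ∀ t : ℕ, 1 ≤ t → ∀ d : ℤ, (d = 1 ∨ d = -1 ∨ d = 2 ∨ d = -2) →
      ∀ (p : ℕ) [Fact p.Prime], p ≠ 2 →
        (((twoIsogenyQuartic (-4 * (t : ℤ)) d (-4 / d)).map (Int.castRingHom ℚ_[p])).IsSoluble ↔
          (p ∣ t ^ 2 + 1 → (d = 1 ∨ d = -1 ∨ p % 8 = 1))) := by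
  sorry

/-- **stub_twoAdicBprime** — the 2-adic table on the `b'`-side (image `B'(t mod 8) = B(t)^⊥ = all, ⟨-1⟩, ⟨-1,5⟩,
⟨-1,10⟩, all, ⟨-1⟩, ⟨-1,5⟩, ⟨-1,2⟩` cut down to `{±1, ±2}`): for `t ≥ 1` and `d ∈ {±1, ±2}`,
`w² = d u⁴ - 4t u²z² - (4/d) z⁴` is `ℚ₂`-soluble iff `d = ±1` or `t ≡ 0 (4)` or `t ≡ 7 (8)`.
Why true / how: `d = 1`: the point `(1:0:1)`; `d = -1`: `(0:1:2)` (`-4/d = 4 = 2²`); `d = ±2`: 16 cells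
`(d, t mod 8)`, insoluble ones by exhaustion mod `2^k` (`k ≤ 6`, as cdisprove did for `t = 1, 2, 3` "killed at 2 by
decide mod 16/32"), soluble ones (`t ≡ 0, 4, 7 (8)`) by an approximate point mod `2^6` + Hensel
(`exists_sq_eq_of_norm_sub_lt`).  Size M.
Numerics: verify_tables.py S5 0 failures t ≤ 400; ellrootno(E_t, 2) = w(t) 3000/3000 (j005061) is the same table. -/
theorem stub_twoAdicBprime :
    ∀ t : ℕ, 1 ≤ t → ∀ d : ℤ, (d = 1 ∨ d = -1 ∨ d = 2 ∨ d = -2) →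
      (((twoIsogenyQuartic (-4 * (t : ℤ)) d (-4 / d)).map (Int.castRingHom ℚ_[2])).IsSoluble ↔
        (d = 1 ∨ d = -1 ∨ t % 4 = 0 ∨ t % 8 = 7)) := by
  sorry

/-- **stub_count** — the COUNT with the ε-cancellation (card's lever (iii); elementary, no curve in sight): for `t ≥ 1`,
with `S_b(t)` = the squarefree divisors of `t²+1` passing the table of `stub_twoAdicB` and
`s'(t) = 2` if (`t ≡ 0 (4) ∨ t ≡ 7 (8)`) and every odd prime factor of `t²+1` is `≡ 1 (8)`, else `1`
(`= log₂ #S(-4t,-4)` by stubs 4–5):  `log₂ #S_b(t) + s'(t) ≡ ω_odd(t²+1) + [t mod 4 ≥ 2] (mod 2)`.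
Why true: every prime factor of `t²+1` other than `2` is `≡ 1 (4)`, so `d ↦ d mod 8` is the character "number of prime
factors `≡ 5 (8)`, mod 2" on the `𝔽₂`-space of squarefree divisors; hence `#S_b = 2^{ω - r}` with `r = 0`
(`t ≡ 1,2 (4)`), `r = ε` (`t ≡ 0 (4)` or `7 (8)`), `r = 1` (`t ≡ 3 (8)`), `ε = [∃ p ∣ t²+1, p ≡ 5 (8)]`, while
`s' = 2 - ε` resp. `1`; `ε` cancels and `ω = ω_odd + [t odd]`.  The prover must exhibit `#S_b` as a power of two
(`Nat.log 2` is exact only then; TRIAGE-r1-3).  Size M/L (divisor-lattice combinatorics over `Nat.divisors`,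
`Nat.primeFactors`, `Finset.card_filter`).
Numerics: verify_tables.py S6 + `#S_b = 2^{ω-r}` 0 failures t ≤ 400; Cassels' exact formula 4000/4000 (j004946). -/
theorem stub_count :
    ∀ t : ℕ, 1 ≤ t →
      (Nat.log 2 ((t ^ 2 + 1).divisors.filter fun d : ℕ =>
            Squarefree d ∧
              (t % 4 = 1 ∨ t % 4 = 2 ∨ d % 8 = 1 ∨ (t % 8 = 3 ∧ d % 16 = 10) ∨ (t % 8 = 7 ∧ d % 16 = 2))).card
          + (if (t % 4 = 0 ∨ t % 8 = 7) ∧ (∀ p ∈ (t ^ 2 + 1).primeFactors, p ≠ 2 → p % 8 = 1) then 2 else 1)) % 2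
        = (((t ^ 2 + 1).primeFactors.filter (fun p : ℕ => p ≠ 2)).card + if t % 4 < 2 then 0 else 1) % 2 := by
  sorry

/-! ## Composition (real proofs; no `sorry` below this line) -/

/-- Real place, `b`-side: for `d < 0`, `d ∣ t²+1`, the form `d u⁴ + 2t u²z² + ((t²+1)/d) z⁴` is negative definite
(`d·q = (du² + tz²)² + z⁴`), so `w² = q` has no real point.  (The tree's
`not_isSoluble_real_twoIsogenyQuartic_of_neg` needs `a ≤ 0` and does not apply; TRIAGE-r1-2 sharpening.) -/
theorem not_isSoluble_real_of_neg {t : ℕ} {d : ℤ} (hd : d < 0) (hdb : d ∣ (t : ℤ) ^ 2 + 1) :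
    ¬ ((twoIsogenyQuartic (2 * (t : ℤ)) d (((t : ℤ) ^ 2 + 1) / d)).map (Int.castRingHom ℝ)).IsSoluble := by
  obtain ⟨e, he⟩ := hdb
  have hde : ((t : ℤ) ^ 2 + 1) / d = e := by rw [he, Int.mul_ediv_cancel_left _ hd.ne]
  rintro ⟨u, z, w, h0, h⟩
  rw [hde, eval_map_twoIsogenyQuartic] at h
  simp only [eq_intCast, Int.cast_mul, Int.cast_ofNat, Int.cast_natCast] at h
  have hd' : (d : ℝ) < 0 := by exact_mod_cast hd
  have hde' : (d : ℝ) * e = (t : ℝ) ^ 2 + 1 := by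
    have := congrArg (Int.cast : ℤ → ℝ) he
    push_cast at this
    linarith
  have key : (d : ℝ) * w ^ 2 = ((d : ℝ) * u ^ 2 + (t : ℝ) * z ^ 2) ^ 2 + z ^ 4 := by
    rw [h]; linear_combination (z ^ 4) * hde'
  have hw : (d : ℝ) * w ^ 2 ≤ 0 := mul_nonpos_of_nonpos_of_nonneg hd'.le (sq_nonneg w)
  have hz4 : z ^ 4 ≤ 0 := by nlinarith [sq_nonneg ((d : ℝ) * u ^ 2 + (t : ℝ) * z ^ 2)]
  have hz : z = 0 := pow_eq_zero_iff (n := 4) (by norm_num) |>.mp (le_antisymm hz4 (by positivity))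
  have hsq : ((d : ℝ) * u ^ 2 + (t : ℝ) * z ^ 2) ^ 2 ≤ 0 := by nlinarith [sq_nonneg (z ^ 2)]
  have hdu : (d : ℝ) * u ^ 2 = 0 := by
    have h1 : ((d : ℝ) * u ^ 2 + (t : ℝ) * z ^ 2) ^ 2 = 0 := le_antisymm hsq (sq_nonneg _)
    have h2 := pow_eq_zero_iff (n := 2) (by norm_num) |>.mp h1
    simpa [hz] using h2
  have hu : u = 0 := by
    rcases mul_eq_zero.mp hdu with h | h
    · exact absurd h hd'.ne
    · exact pow_eq_zero_iff (n := 2) (by norm_num) |>.mp h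
  rcases h0 with h0 | h0
  · exact h0 hu
  · exact h0 hz

/-- **The `b`-side Selmer set is the explicit divisor set** (stubs 2, 3 + the real place). -/
theorem selmerB_eq (t : ℕ) (ht : 1 ≤ t) :
    twoIsogenySelmerGroup (2 * (t : ℤ)) ((t : ℤ) ^ 2 + 1) = (setB t).image (Nat.cast : ℕ → ℤ) := by
  have hb : ((t : ℤ) ^ 2 + 1) ≠ 0 := by positivity
  ext d
  rw [mem_twoIsogenySelmerGroup_iff hb, BinaryQuartic.IsLocallySoluble, Finset.mem_image]
  constructor
  · rintro ⟨hsq, hdvd, hreal, hloc⟩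
    have hd0 : d ≠ 0 := hsq.ne_zero
    have hdpos : 0 < d := by
      rcases lt_or_gt_of_ne hd0 with hneg | hpos
      · exact absurd hreal (not_isSoluble_real_of_neg hneg hdvd)
      · exact hpos
    obtain ⟨n, rfl⟩ : ∃ n : ℕ, (n : ℤ) = d := ⟨d.toNat, Int.toNat_of_nonneg hdpos.le⟩
    refine ⟨n, ?_, rfl⟩
    rw [setB, Finset.mem_filter, Nat.mem_divisors]
    have h2 := (stub_twoAdicB t ht n hdpos hsq hdvd).mp (hloc 2)
    refine ⟨⟨by exact_mod_cast hdvd, by positivity⟩, Int.squarefree_natCast.mp hsq, ?_⟩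
    omega
  · rintro ⟨n, hn, rfl⟩
    rw [setB, Finset.mem_filter, Nat.mem_divisors] at hn
    obtain ⟨⟨hdvd, -⟩, hsq, hC⟩ := hn
    have hn0 : n ≠ 0 := fun h => by simp [h] at hsq
    have hpos : (0 : ℤ) < n := by exact_mod_cast Nat.pos_of_ne_zero hn0
    have hsqZ : Squarefree (n : ℤ) := Int.squarefree_natCast.mpr hsq
    have hdvdZ : (n : ℤ) ∣ (t : ℤ) ^ 2 + 1 := by exact_mod_cast hdvd
    refine ⟨hsqZ, hdvdZ, isSoluble_real_twoIsogenyQuartic_of_pos hpos _ _, fun p hp => ?_⟩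
    by_cases hp2 : p = 2
    · subst hp2
      exact (stub_twoAdicB t ht n hpos hsqZ hdvdZ).mpr (by omega)
    · exact stub_oddPlacesB t ht n hpos hsqZ hdvdZ p hp2

/-- The squarefree divisors of `-4` are `±1, ±2`. -/
theorem squarefree_dvd_neg_four_iff (d : ℤ) :
    (Squarefree d ∧ d ∣ (-4 : ℤ)) ↔ (d = 1 ∨ d = -1 ∨ d = 2 ∨ d = -2) := by
  constructor
  · rintro ⟨hsq, hdvd⟩
    have h4 : d.natAbs ∣ 4 := by simpa using Int.natAbs_dvd_natAbs.mpr hdvd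
    have hle : d.natAbs ≤ 4 := Nat.le_of_dvd (by norm_num) h4
    have hsqn : Squarefree d.natAbs := Int.squarefree_natAbs.mpr hsq
    have h0 : d.natAbs ≠ 0 := fun h => by simp [h] at hsqn
    have h3 : d.natAbs ≠ 3 := fun h => by rw [h] at h4; omega
    have h4' : d.natAbs ≠ 4 := by
      intro h
      rw [h] at hsqn
      have h22 := hsqn 2 ⟨1, by norm_num⟩
      simp at h22
    omega
  · rintro (rfl | rfl | rfl | rfl)
    · exact ⟨squarefree_one, by norm_num⟩
    · exact ⟨isUnit_one.neg.squarefree, by norm_num⟩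
    · exact ⟨Int.prime_two.squarefree, by norm_num⟩
    · exact ⟨Int.prime_two.neg.squarefree, by norm_num⟩

/-- **Membership in the `b'`-side Selmer set** (stubs 4, 5; the real place is automatic since `d · (-4/d) < 0`). -/
theorem mem_selmerBprime_iff (t : ℕ) (ht : 1 ≤ t) (d : ℤ) :
    d ∈ twoIsogenySelmerGroup (-4 * (t : ℤ)) (-4) ↔
      (d = 1 ∨ d = -1) ∨ ((d = 2 ∨ d = -2) ∧ (t % 4 = 0 ∨ t % 8 = 7) ∧
        ∀ p ∈ (t ^ 2 + 1).primeFactors, p ≠ 2 → p % 8 = 1) := by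
  have hb : (-4 : ℤ) ≠ 0 := by norm_num
  have ht0 : t ^ 2 + 1 ≠ 0 := by positivity
  -- real solubility for the four candidates
  have hreal : ∀ d : ℤ, (d = 1 ∨ d = -1 ∨ d = 2 ∨ d = -2) →
      ((twoIsogenyQuartic (-4 * (t : ℤ)) d (-4 / d)).map (Int.castRingHom ℝ)).IsSoluble := by
    rintro d (rfl | rfl | rfl | rfl)
    · exact isSoluble_real_twoIsogenyQuartic_of_pos one_pos _ _
    · exact isSoluble_real_twoIsogenyQuartic_of_pos_right (by norm_num) _ _
    · exact isSoluble_real_twoIsogenyQuartic_of_pos two_pos _ _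
    · exact isSoluble_real_twoIsogenyQuartic_of_pos_right (by norm_num) _ _
  rw [mem_twoIsogenySelmerGroup_iff hb, BinaryQuartic.IsLocallySoluble, ← and_assoc,
    squarefree_dvd_neg_four_iff]
  constructor
  · rintro ⟨hd, -, hloc⟩
    have h2 := (stub_twoAdicBprime t ht d hd).mp (hloc 2)
    have hodd : ∀ p ∈ (t ^ 2 + 1).primeFactors, p ≠ 2 → (d = 1 ∨ d = -1 ∨ p % 8 = 1) := by
      intro p hp hp2
      obtain ⟨hpp, hpd, -⟩ := Nat.mem_primeFactors.mp hp
      haveI : Fact p.Prime := ⟨hpp⟩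
      exact (stub_oddPlacesBprime t ht d hd p hp2).mp (hloc p) hpd
    rcases hd with rfl | rfl | rfl | rfl
    · exact Or.inl (Or.inl rfl)
    · exact Or.inl (Or.inr rfl)
    · refine Or.inr ⟨Or.inl rfl, by omega, fun p hp hp2 => ?_⟩
      have := hodd p hp hp2; omega
    · refine Or.inr ⟨Or.inr rfl, by omega, fun p hp hp2 => ?_⟩
      have := hodd p hp hp2; omega
  · rintro (hd | ⟨hd, h478, hall⟩)
    · have hd4 : d = 1 ∨ d = -1 ∨ d = 2 ∨ d = -2 := by omega
      refine ⟨hd4, hreal d hd4, fun p hp => ?_⟩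
      by_cases hp2 : p = 2
      · subst hp2
        exact (stub_twoAdicBprime t ht d hd4).mpr (by omega)
      · exact (stub_oddPlacesBprime t ht d hd4 p hp2).mpr (fun _ => by omega)
    · have hd4 : d = 1 ∨ d = -1 ∨ d = 2 ∨ d = -2 := by omega
      refine ⟨hd4, hreal d hd4, fun p hp => ?_⟩
      by_cases hp2 : p = 2
      · subst hp2
        exact (stub_twoAdicBprime t ht d hd4).mpr (by omega)
      · refine (stub_oddPlacesBprime t ht d hd4 p hp2).mpr (fun hpd => Or.inr (Or.inr ?_))
        exact hall p (Nat.mem_primeFactors.mpr ⟨hp.out, hpd, ht0⟩) hp2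

/-- **The `b'`-side Selmer set is the explicit set `setBprime t`.** -/
theorem selmerBprime_eq (t : ℕ) (ht : 1 ≤ t) :
    twoIsogenySelmerGroup' (2 * (t : ℤ)) ((t : ℤ) ^ 2 + 1) = setBprime t := by
  have hab : twoIsogenySelmerGroup' (2 * (t : ℤ)) ((t : ℤ) ^ 2 + 1) =
      twoIsogenySelmerGroup (-4 * (t : ℤ)) (-4) := by
    rw [twoIsogenySelmerGroup'_eq]; congr 1 <;> ring
  rw [hab]
  ext d
  rw [mem_selmerBprime_iff t ht d, setBprime]
  split_ifs with hc
  · simp only [Finset.mem_insert, Finset.mem_singleton]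
    constructor
    · rintro (h | ⟨h, -⟩) <;> omega
    · intro h
      rcases h with h | h | h | h
      · exact Or.inl (Or.inl h)
      · exact Or.inl (Or.inr h)
      · exact Or.inr ⟨Or.inl h, hc⟩
      · exact Or.inr ⟨Or.inr h, hc⟩
  · simp only [Finset.mem_insert, Finset.mem_singleton]
    constructor
    · rintro (h | ⟨-, h⟩)
      · exact h
      · exact absurd h hc
    · exact fun h => Or.inl h

/-- `log₂ #setBprime t` is `2` or `1`. -/
theorem log_card_setBprime (t : ℕ) :
    Nat.log 2 (setBprime t).card =
      if (t % 4 = 0 ∨ t % 8 = 7) ∧ (∀ p ∈ (t ^ 2 + 1).primeFactors, p ≠ 2 → p % 8 = 1) then 2 else 1 := by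
  unfold setBprime
  split_ifs
  · rw [show ({1, -1, 2, -2} : Finset ℤ).card = 2 ^ 2 by decide, Nat.log_pow one_lt_two]
  · rw [show ({1, -1} : Finset ℤ).card = 2 ^ 1 by decide, Nat.log_pow one_lt_two]

/-- **Composition (the skeleton theorem).** The crux `PencilSelmerDictionary`, concluded BY NAME, with the sharp
witness `M = 2`, `w t = if t % 4 < 2 then -1 else 1` — a closed term over the six registered stubs. -/
theorem PencilSelmerDictionary_of : PencilSelmerDictionary := by
  refine ⟨2, fun t => if t % 4 < 2 then -1 else 1, fun t => ?_, fun t ht => ?_⟩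
  · have h4 : (t + 2 ^ 2) % 4 = t % 4 := by omega
    simp only [h4]
  · have hb : ((t : ℤ) ^ 2 + 1) * ((2 * (t : ℤ)) ^ 2 - 4 * ((t : ℤ) ^ 2 + 1)) ≠ 0 := by
      rw [show (2 * (t : ℤ)) ^ 2 - 4 * ((t : ℤ) ^ 2 + 1) = -4 by ring]
      exact mul_ne_zero (by positivity) (by norm_num)
    have hC := stub_cassels (2 * (t : ℤ)) ((t : ℤ) ^ 2 + 1) hb
    push_cast at hC
    rw [hC]
    have hs : twoIsogenySelmerRank (2 * (t : ℤ)) ((t : ℤ) ^ 2 + 1) = Nat.log 2 (setB t).card := by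
      rw [twoIsogenySelmerRank, selmerB_eq t ht, Finset.card_image_of_injective _ Nat.cast_injective]
    have hs' : twoIsogenySelmerRank' (2 * (t : ℤ)) ((t : ℤ) ^ 2 + 1) =
        if (t % 4 = 0 ∨ t % 8 = 7) ∧ (∀ p ∈ (t ^ 2 + 1).primeFactors, p ≠ 2 → p % 8 = 1) then 2 else 1 := by
      rw [twoIsogenySelmerRank'_eq, selmerBprime_eq t ht, log_card_setBprime]
    rw [hs, hs', neg_one_pow_eq_pow_mod_two (R := ℤ)]
    unfold setB
    rw [stub_count t ht, ← neg_one_pow_eq_pow_mod_two]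
    dsimp only
    split_ifs <;> ring

end Summit.Parity.BatemanHorn.Cruxes.PencilSelmerDictionary.CasselsLocalImagesMod4

end
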